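import Literature.MathematicalPhysics.QuantumFieldTheory.IsingGaugePlaquetteCovarianceDuality
import Literature.Probability.LatticeModels.IsingPairCovarianceBound
import Literature.Probability.LatticeModels.IsingSupercriticalTruncatedDecay
import HarnessLib

/-!
# The plaquette–plaquette mass gap of `ℤ₂` lattice gauge theory on `ℤ³` in the CONFINED phase,
# modulo Duminil-Copin–Goswami–Raoufi 2020 — and what then remains of Duncan–Schweinhart's Thm 8

Sequel to `IsingGaugePlaquetteCovarianceDuality.lean` (duality of truncated plaquette correlations,
`z2PlaquettePairCov_eq_sinh_sq_mul_plusCov`: for every `β > 0`,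
`Cov_β(W_{σ(x)}, W_{σ(x)+Ne₃}) = sinh²(2β*)·⟨ε ; ε'⟩⁺_{β*}` with `ε = σ_{x-e₃}σ_x`,
`ε' = σ_{x+(N-1)e₃}σ_{x+Ne₃}` the dual bond energies and `e^{-2β*} = tanh β`; and the deconfined
phase `β > β_c`). Here the CONFINED phase `0 < β < β_c = artanh e^{-2β_c^{Ising}(ℤ³)}`: then
`β* > β_c^{Ising}(ℤ³)` (`criticalBeta_lt_dualBeta`), the dual Ising model is in its PLUS state, and

* the energy–energy covariance of the plus state is bounded by four truncated two-point functions
  (Duminil-Copin–Goswami–Raoufi 2020 Lemma 1.2 for `|A| = |B| = 2` — the tree's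
  `plusCorr_cov_pair_le_sum_truncated`, PROVED from Lebowitz' third inequality),
* so the exponential decay of the plus-state truncated two-point function for `β* > β_c^{Ising}`
  — Duminil-Copin–Goswami–Raoufi 2020 **Thm 1.1** [DuminilCopinGoswamiRaoufi2020], the input
  «[DCGR20]» of Duncan–Schweinhart's own proof (arXiv:2607.02434, proof of Prop. 24, p. 20), taken
  here as an explicit HYPOTHESIS `hDCGR` (the `d = 3` content of the tree's named fact
  `DuminilCopinGoswamiRaoufi2020_truncatedTwoPointPlus_expDecay`, `IsingSupercriticalTruncatedDecay.lean`;
  the `…_of_DCGR2020` corollaries take the named fact itself) — gives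
  `0 ≤ Cov_β(W_{σ(x)}, W_{σ(x)+Ne₃}) ≤ 4 sinh²(2β*) e^{κ} · e^{-κN}`
  (`z2PlaquettePairCov_le_exp_neg_of_lt_critical`), and in the fact's shape `≤ e^{-c₀N}`, `N ≥ 1`;
* **reduction of the named fact**: `DuncanSchweinhart2026_z2GaugeThree_plaquetteCovDecay` (DS26
  Thm 8 for `q = 2`, `d = 3`, both inequalities, all `β ≠ β_c`) follows from DCGR20 Thm 1.1 (at
  `d = 3`) and the LOWER bounds `e^{-c₁N} ≤ Cov_β` alone
  (`DuncanSchweinhart2026_z2GaugeThree_plaquetteCovDecay_of_DCGR_of_lower`, and with the named fact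
  `DuncanSchweinhart2026_z2GaugeThree_plaquetteCovDecay_of_DCGR2020_of_lower`): the upper bound
  («`ξ_β < ∞`», the mass-gap direction) is thereby a theorem modulo [DCGR20] at every `β ≠ β_c` —
  strong coupling unconditionally (`z2PlaquettePairCov_le_exp_neg_of_strongCoupling`, OS78),
  `β > β_c` unconditionally (`z2PlaquettePairCov_le_exp_neg_of_gt_critical`).

HONEST FRAMING: `ℤ₂`, `d = 3` calibration (cell `ym-ir`, census row A5); nothing here bears on
four-dimensional Yang–Mills, on `BalabanLadder.IR`, or on the mass gap (Clay); in the `ym` ladder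
only the conditional finite-`𝕋⁴` rung `BalabanLadder.UV` is closed by any route.

## References

* P. Duncan, B. Schweinhart, arXiv:2607.02434 (2026), Thm 8 (p. 4), Prop. 24 and its proof
  (pp. 19–20: «by Theorem 1.3 of [DCGR20]»). [DuncanSchweinhart2026]
* H. Duminil-Copin, S. Goswami, A. Raoufi, CMP 374 (2020) 891–921, arXiv:1808.00439, Thm 1.1,
  Lemma 1.2. [DuminilCopinGoswamiRaoufi2020]
* M. Aizenman, Math. Phys. Anal. Geom. 28 (2025), arXiv:2509.02850, Thm 9.2. [Aizenman2025]
-/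

noncomputable section

open MeasureTheory Finset Filter Topology
open scoped symmDiff
open Literature.Probability.LatticeModels
open Literature.Barriers.QuantumFields (rootsOfUnityCircle znRep)

namespace Literature.MathematicalPhysics.QuantumFieldTheory

open AreaLaw

namespace Z2Duality

/-! ### §1 The dual temperature is supercritical in the confined phase -/

/-- `tanh β > 0` for `β > 0`. [folklore] -/
private theorem tanh_pos_of_pos₃ {β : ℝ} (hβ : 0 < β) : 0 < Real.tanh β := by
  rw [Real.tanh_eq_sinh_div_cosh]; exact div_pos (Real.sinh_pos_iff.2 hβ) (Real.cosh_pos β)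

/-- **`0 < β < β_c^{LGM} ⟹ β* > β_c^{Ising}(ℤ³)`**: below the gauge critical coupling
`artanh e^{-2β_c^{Ising}}` the dual temperature `β* = -½ log tanh β` is supercritical (the confined
phase of the gauge theory is dual to the ORDERED phase of the Ising model).
[cite: Aizenman2025, §9.1 Thm 9.1 (coth β_c = e^{2β_c^{Ising}}); DuncanSchweinhart2026 proof of Prop. 24 (p. 20)] -/
theorem criticalBeta_lt_dualBeta {β : ℝ} (hβ : 0 < β) (h : β < z2GaugeCriticalBetaThree) :
    criticalBeta 3 < dualBeta β := by
  have hmem := exp_neg_two_mul_criticalBeta_three_mem_Ioo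
  have ht0 := tanh_pos_of_pos₃ hβ
  have htanh : Real.tanh β < Real.exp (-2 * criticalBeta 3) := by
    have h1 : Real.artanh (Real.tanh β) < Real.artanh (Real.exp (-2 * criticalBeta 3)) := by
      rw [Real.artanh_tanh]; exact h
    exact (Real.artanh_lt_artanh_iff ⟨Real.neg_one_lt_tanh β, Real.tanh_lt_one β⟩
      ⟨by linarith [hmem.1], hmem.2⟩).1 h1
  have hlog : Real.log (Real.tanh β) < -2 * criticalBeta 3 := by
    rw [← Real.exp_lt_exp, Real.exp_log ht0]; exact htanh
  rw [dualBeta]; linarith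

/-! ### §2 The dual energy–energy covariance in the plus state under a truncated-two-point bound -/

/-- The sup norm of a lattice vector dominates its `e₃`-coordinate. [folklore] -/
private theorem abs_apply_two_le_norm₃ (v : Probability.LatticeModels.Site 3) : |((v 2 : ℤ) : ℝ)| ≤ ‖v‖ := by
  have h := norm_le_pi_norm v 2
  rwa [Int.norm_eq_abs] at h

/-- A pair of distinct points is the symmetric difference of the singletons. [folklore] -/
private theorem pair_eq_symmDiff {α : Type*} [DecidableEq α] {a b : α} (h : a ≠ b) :
    ({a, b} : Finset α) = ({a} : Finset α) ∆ {b} := by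
  ext z
  simp only [Finset.mem_insert, Finset.mem_singleton, Finset.mem_symmDiff]
  constructor
  · rintro (rfl | rfl)
    · exact Or.inl ⟨rfl, h⟩
    · exact Or.inr ⟨rfl, fun e => h e.symm⟩
  · rintro (⟨h1, -⟩ | ⟨h1, -⟩)
    · exact Or.inl h1
    · exact Or.inr h1

/-- `verts {σ(w)} = {w - e₃} ∆ {w}`. [cite: Aizenman2025, §9.2] -/
theorem verts_unitPlaq_eq_symmDiff (w : Probability.LatticeModels.Site 3) :
    verts {((w, 0, 1) : Plaq 3)} =
      ({w - Pi.single 2 1} : Finset (Probability.LatticeModels.Site 3)) ∆ {w} := by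
  rw [verts_unitPlaq]
  refine pair_eq_symmDiff ?_
  intro h
  have := congrFun h 2
  simp at this

/-- A truncated-two-point bound along the `e₃`-axis: if `⟨σ_a;σ_b⟩⁺ ≤ e^{-κ‖b-a‖}` for all `a, b`
then for points whose `e₃`-coordinates differ by `D ≥ N - 1`, `⟨σ_a;σ_b⟩⁺ ≤ e^{-κ(N-1)}`.
[cite: DuminilCopinGoswamiRaoufi2020, Thm 1.1] -/
private theorem truncated_le_of_coord {β κ : ℝ} (hκ : 0 < κ)
    (hdec : ∀ a b : Probability.LatticeModels.Site 3,
      plusCorr 3 β 0 (({a} : Finset (Probability.LatticeModels.Site 3)) ∆ {b}) -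
        plusCorr 3 β 0 {a} * plusCorr 3 β 0 {b} ≤ Real.exp (-(κ * ‖a - b‖)))
    {a b : Probability.LatticeModels.Site 3} {D : ℝ} (hD : D ≤ |(((a - b) 2 : ℤ) : ℝ)|) :
    plusCorr 3 β 0 (({a} : Finset (Probability.LatticeModels.Site 3)) ∆ {b}) -
        plusCorr 3 β 0 {a} * plusCorr 3 β 0 {b} ≤ Real.exp (-(κ * D)) := by
  refine (hdec a b).trans (Real.exp_le_exp.2 ?_)
  have h := (hD.trans (abs_apply_two_le_norm₃ (a - b)))
  nlinarith

/-- **The dual energy–energy covariance decays with the truncated-two-point rate** (plus state of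
`ℤ³`, `β ≥ 0`): if `⟨σ_a;σ_b⟩⁺_β ≤ e^{-κ‖a-b‖}` for all `a, b`, then for the dual bonds
`ε = {x-e₃,x}`, `ε' = {x+(N-1)e₃, x+Ne₃}`,
`⟨σ_εσ_{ε'}⟩⁺ - ⟨σ_ε⟩⁺⟨σ_{ε'}⟩⁺ ≤ 4 e^{-κ(N-1)}` — by `plusCorr_cov_pair_le_sum_truncated`
(DCGR Lemma 1.2 for `|A| = |B| = 2`, proved in the tree) and the four axis distances `N-1, N, N, N+1`.
[cite: DuminilCopinGoswamiRaoufi2020, Lemma 1.2 and Thm 1.1] -/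
theorem plusCov_dualBonds_le {β κ : ℝ} (hβ : 0 ≤ β) (hκ : 0 < κ)
    (hdec : ∀ a b : Probability.LatticeModels.Site 3,
      plusCorr 3 β 0 (({a} : Finset (Probability.LatticeModels.Site 3)) ∆ {b}) -
        plusCorr 3 β 0 {a} * plusCorr 3 β 0 {b} ≤ Real.exp (-(κ * ‖a - b‖)))
    (x : Probability.LatticeModels.Site 3) (N : ℕ) :
    plusCorr 3 β 0 (verts {((x, 0, 1) : Plaq 3)} ∆ verts {((x + Pi.single 2 (N : ℤ), 0, 1) : Plaq 3)}) -
        plusCorr 3 β 0 (verts {((x, 0, 1) : Plaq 3)}) *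
          plusCorr 3 β 0 (verts {((x + Pi.single 2 (N : ℤ), 0, 1) : Plaq 3)}) ≤
      4 * Real.exp (-(κ * ((N : ℝ) - 1))) := by
  rw [verts_unitPlaq_eq_symmDiff, verts_unitPlaq_eq_symmDiff]
  have hmain := plusCorr_cov_pair_le_sum_truncated (d := 3) hβ le_rfl
    (x - Pi.single 2 1) x (x + Pi.single 2 (N : ℤ) - Pi.single 2 1) (x + Pi.single 2 (N : ℤ))
  -- the four axis distances: `e₃`-coordinates of the differences are `-N, -(N+1), -(N-1), -N`
  have e1 : ((((x - Pi.single 2 1) - (x + Pi.single 2 (N : ℤ) - Pi.single 2 1) : Probability.LatticeModels.Site 3) 2 : ℤ) : ℝ) = -(N : ℝ) := by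
    simp only [Pi.sub_apply, Pi.add_apply, Pi.single_eq_same]; push_cast; ring
  have e2 : ((((x - Pi.single 2 1) - (x + Pi.single 2 (N : ℤ)) : Probability.LatticeModels.Site 3) 2 : ℤ) : ℝ) = -((N : ℝ) + 1) := by
    simp only [Pi.sub_apply, Pi.add_apply, Pi.single_eq_same]; push_cast; ring
  have e3 : (((x - (x + Pi.single 2 (N : ℤ) - Pi.single 2 1) : Probability.LatticeModels.Site 3) 2 : ℤ) : ℝ) = -((N : ℝ) - 1) := by
    simp only [Pi.sub_apply, Pi.add_apply, Pi.single_eq_same]; push_cast; ring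
  have e4 : (((x - (x + Pi.single 2 (N : ℤ)) : Probability.LatticeModels.Site 3) 2 : ℤ) : ℝ) = -(N : ℝ) := by
    simp only [Pi.sub_apply, Pi.add_apply, Pi.single_eq_same]; push_cast; ring
  have d1 : ((N : ℝ) - 1) ≤ |((((x - Pi.single 2 1) - (x + Pi.single 2 (N : ℤ) - Pi.single 2 1) : Probability.LatticeModels.Site 3) 2 : ℤ) : ℝ)| := by
    rw [e1]; exact le_abs.2 (Or.inr (by linarith))
  have d2 : ((N : ℝ) - 1) ≤ |((((x - Pi.single 2 1) - (x + Pi.single 2 (N : ℤ)) : Probability.LatticeModels.Site 3) 2 : ℤ) : ℝ)| := by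
    rw [e2]; exact le_abs.2 (Or.inr (by linarith))
  have d3 : ((N : ℝ) - 1) ≤ |(((x - (x + Pi.single 2 (N : ℤ) - Pi.single 2 1) : Probability.LatticeModels.Site 3) 2 : ℤ) : ℝ)| := by
    rw [e3]; exact le_abs.2 (Or.inr (by linarith))
  have d4 : ((N : ℝ) - 1) ≤ |(((x - (x + Pi.single 2 (N : ℤ)) : Probability.LatticeModels.Site 3) 2 : ℤ) : ℝ)| := by
    rw [e4]; exact le_abs.2 (Or.inr (by linarith))
  have t1 := truncated_le_of_coord hκ hdec d1
  have t2 := truncated_le_of_coord hκ hdec d2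
  have t3 := truncated_le_of_coord hκ hdec d3
  have t4 := truncated_le_of_coord hκ hdec d4
  linarith

/-! ### §3 The confined phase modulo [DCGR20] -/

/-- **The plaquette–plaquette mass gap of `ℤ₂` LGT₃ in the CONFINED phase, modulo
Duminil-Copin–Goswami–Raoufi 2020 Thm 1.1** (the `0 < β < β_c` half of the upper bound of
Duncan–Schweinhart 2026 Thm 8 ∕ Prop. 24 for `q = 2`, `d = 3`): granting the exponential decay of
the plus-state truncated two-point function of the three-dimensional Ising model above `β_c`
(hypothesis `hDCGR`, the shape of `DuminilCopinGoswamiRaoufi2020_truncatedTwoPointPlus_expDecay 3`),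
for every `0 < β < β_c` there are `m > 0` and `c` with `0 ≤ Cov_β(W_{σ(x)}, W_{σ(x)+Ne₃}) ≤ c e^{-mN}`
for all `x`, `N` (`m = κ(β*)`, `c = max 1 (4 sinh²(2β*) e^{κ})`).
[cite: DuncanSchweinhart2026, Thm 8 (p. 4) and proof of Prop. 24 (p. 20, «by Theorem 1.3 of [DCGR20]»); DuminilCopinGoswamiRaoufi2020 Thm 1.1] -/
theorem z2PlaquettePairCov_le_exp_neg_of_lt_critical
    (hDCGR : ∀ β : ℝ, criticalBeta 3 < β → ∃ c : ℝ, 0 < c ∧ ∀ a b : Probability.LatticeModels.Site 3,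
      plusCorr 3 β 0 (({a} : Finset (Probability.LatticeModels.Site 3)) ∆ {b}) -
        plusCorr 3 β 0 {a} * plusCorr 3 β 0 {b} ≤ Real.exp (-(c * ‖a - b‖)))
    {β : ℝ} (hβ : 0 < β) (h : β < z2GaugeCriticalBetaThree) :
    ∃ m c : ℝ, 0 < m ∧ ∀ (x : Probability.LatticeModels.Site 3) (N : ℕ),
      0 ≤ z2PlaquettePairCov β x N ∧ z2PlaquettePairCov β x N ≤ c * Real.exp (-(m * N)) := by
  have hβs0 : 0 < dualBeta β := dualBeta_pos hβ
  obtain ⟨κ, hκ, hdec⟩ := hDCGR (dualBeta β) (criticalBeta_lt_dualBeta hβ h)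
  refine ⟨κ, max 1 (4 * Real.sinh (2 * dualBeta β) ^ 2 * Real.exp κ), hκ, fun x N => ?_⟩
  refine ⟨(z2PlaquettePairCov_mem_Icc hβ.le x N).1, ?_⟩
  rcases Nat.eq_zero_or_pos N with rfl | hN
  · have h1 : z2PlaquettePairCov β x 0 ≤ 1 := (z2PlaquettePairCov_mem_Icc hβ.le x 0).2
    have h2 : (1 : ℝ) ≤ max 1 (4 * Real.sinh (2 * dualBeta β) ^ 2 * Real.exp κ) := le_max_left _ _
    simpa using h1.trans h2
  · have hcov := plusCov_dualBonds_le hβs0.le hκ hdec x N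
    rw [z2PlaquettePairCov_eq_sinh_sq_mul_plusCov hβ x hN]
    have hs : 0 ≤ Real.sinh (2 * dualBeta β) ^ 2 := sq_nonneg _
    have hexp : Real.exp (-(κ * ((N : ℝ) - 1))) = Real.exp κ * Real.exp (-(κ * N)) := by
      rw [← Real.exp_add]; congr 1; ring
    have h1 := mul_le_mul_of_nonneg_left hcov hs
    rw [hexp] at h1
    have h2 : 4 * Real.sinh (2 * dualBeta β) ^ 2 * Real.exp κ ≤
        max 1 (4 * Real.sinh (2 * dualBeta β) ^ 2 * Real.exp κ) := le_max_right _ _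
    have h3 : 0 < Real.exp (-(κ * N)) := Real.exp_pos _
    calc _ ≤ Real.sinh (2 * dualBeta β) ^ 2 * (4 * (Real.exp κ * Real.exp (-(κ * N)))) := h1
      _ = (4 * Real.sinh (2 * dualBeta β) ^ 2 * Real.exp κ) * Real.exp (-(κ * N)) := by ring
      _ ≤ max 1 (4 * Real.sinh (2 * dualBeta β) ^ 2 * Real.exp κ) * Real.exp (-(κ * N)) :=
          mul_le_mul_of_nonneg_right h2 h3.le

end Z2Duality

/-! ### §4 The fact's shape, and what remains of Duncan–Schweinhart's Thm 8 -/

section FactShape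

open Z2Duality

/-- Calculus: `c ≤ e^{(m/2) N₁}` for some `N₁ ≥ 1`. [folklore] -/
private theorem exists_nat_exp_ge' {m : ℝ} (hm : 0 < m) (c : ℝ) :
    ∃ N₁ : ℕ, 1 ≤ N₁ ∧ c ≤ Real.exp (m / 2 * N₁) := by
  obtain ⟨n, hn⟩ := exists_nat_ge (2 * c / m)
  refine ⟨n + 1, by omega, ?_⟩
  have h1 : c ≤ m / 2 * ((n + 1 : ℕ) : ℝ) := by
    push_cast
    have : 2 * c / m * (m / 2) = c := by field_simp
    nlinarith
  exact h1.trans ((by linarith : m / 2 * ((n + 1 : ℕ) : ℝ) ≤ 1 + m / 2 * ((n + 1 : ℕ) : ℝ)).trans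
    (Real.add_one_le_exp _ |>.trans_eq' (by ring)))

/-- **Absorbing the prefactor**: for `β > 0`, a bound `Cov_β ≤ c e^{-mN}` (all `x`, `N`) with `m > 0`
gives `c₀ > 0` with `Cov_β(W_{σ(x)}, W_{σ(x)+Ne₃}) ≤ e^{-c₀N}` for all `x` and all `N ≥ 1`, because
`Cov_β ≤ 1 - tanh²β < 1` (`z2PlaquettePairCov_le_one_sub_tanh_sq`).
[cite: DuncanSchweinhart2026, Prop. 24 (Cov ≤ e^{-c₀N}, p. 19)] -/
theorem z2PlaquettePairCov_le_exp_neg_of_prefactor {β : ℝ} (hβ : 0 < β) {m c : ℝ} (hm : 0 < m)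
    (hmc : ∀ (x : Probability.LatticeModels.Site 3) (N : ℕ),
      z2PlaquettePairCov β x N ≤ c * Real.exp (-(m * N))) :
    ∃ c₀ : ℝ, 0 < c₀ ∧ ∀ (x : Probability.LatticeModels.Site 3) (N : ℕ), 1 ≤ N →
      z2PlaquettePairCov β x N ≤ Real.exp (-(c₀ * N)) := by
  obtain ⟨N₁, hN₁, hcN₁⟩ := exists_nat_exp_ge' hm c
  set q : ℝ := 1 - Real.tanh β ^ 2 with hq
  have ht0 : 0 < Real.tanh β := by
    rw [Real.tanh_eq_sinh_div_cosh]; exact div_pos (Real.sinh_pos_iff.2 hβ) (Real.cosh_pos β)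
  have ht1 : Real.tanh β < 1 := Real.tanh_lt_one β
  have hq0 : 0 < q := by rw [hq]; nlinarith
  have hq1 : q < 1 := by rw [hq]; nlinarith
  have hlq : 0 < -Real.log q := by rw [neg_pos]; exact Real.log_neg hq0 hq1
  have hN₁' : (0 : ℝ) < N₁ := by exact_mod_cast hN₁
  refine ⟨min (m / 2) (-Real.log q / N₁), lt_min (by linarith) (div_pos hlq hN₁'), fun x N hN => ?_⟩
  have hc0m : min (m / 2) (-Real.log q / N₁) ≤ m / 2 := min_le_left _ _
  have hc0q : min (m / 2) (-Real.log q / N₁) ≤ -Real.log q / N₁ := min_le_right _ _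
  have hN0 : (0 : ℝ) ≤ N := by exact_mod_cast (Nat.zero_le N)
  rcases le_or_gt N₁ N with hle | hlt
  · have hle' : (N₁ : ℝ) ≤ N := by exact_mod_cast hle
    refine (hmc x N).trans ?_
    have hc' : c ≤ Real.exp (m / 2 * N) :=
      hcN₁.trans (Real.exp_le_exp.2 (mul_le_mul_of_nonneg_left hle' (by linarith)))
    calc c * Real.exp (-(m * N)) ≤ Real.exp (m / 2 * N) * Real.exp (-(m * N)) :=
          mul_le_mul_of_nonneg_right hc' (Real.exp_pos _).le
      _ = Real.exp (-(m / 2 * N)) := by rw [← Real.exp_add]; congr 1; ring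
      _ ≤ Real.exp (-(min (m / 2) (-Real.log q / N₁) * N)) :=
          Real.exp_le_exp.2 (by nlinarith)
  · have hlt' : (N : ℝ) ≤ N₁ := by exact_mod_cast hlt.le
    refine (z2PlaquettePairCov_le_one_sub_tanh_sq hβ.le x N).trans ?_
    have h1 : min (m / 2) (-Real.log q / N₁) * N ≤ -Real.log q / N₁ * N₁ :=
      (mul_le_mul_of_nonneg_right hc0q hN0).trans
        (mul_le_mul_of_nonneg_left hlt' (div_pos hlq hN₁').le)
    rw [div_mul_cancel₀ _ hN₁'.ne'] at h1
    rw [← hq]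
    calc q = Real.exp (Real.log q) := (Real.exp_log hq0).symm
      _ ≤ Real.exp (-(min (m / 2) (-Real.log q / N₁) * N)) := Real.exp_le_exp.2 (by linarith)

/-- **The confined-phase upper bound in the shape of Duncan–Schweinhart's Thm 8, modulo [DCGR20]**:
for `0 < β < β_c` there is `c₀ > 0` with `Cov_β(W_{σ(x)}, W_{σ(x)+Ne₃}) ≤ e^{-c₀N}` for all `x`, `N ≥ 1`.
[cite: DuncanSchweinhart2026, Thm 8 (p. 4) and Prop. 24 (pp. 19–20); DuminilCopinGoswamiRaoufi2020 Thm 1.1] -/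
theorem z2PlaquettePairCov_le_exp_neg_of_lt_critical'
    (hDCGR : ∀ β : ℝ, criticalBeta 3 < β → ∃ c : ℝ, 0 < c ∧ ∀ a b : Probability.LatticeModels.Site 3,
      plusCorr 3 β 0 (({a} : Finset (Probability.LatticeModels.Site 3)) ∆ {b}) -
        plusCorr 3 β 0 {a} * plusCorr 3 β 0 {b} ≤ Real.exp (-(c * ‖a - b‖)))
    {β : ℝ} (hβ : 0 < β) (h : β < z2GaugeCriticalBetaThree) :
    ∃ c₀ : ℝ, 0 < c₀ ∧ ∀ (x : Probability.LatticeModels.Site 3) (N : ℕ), 1 ≤ N →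
      z2PlaquettePairCov β x N ≤ Real.exp (-(c₀ * N)) := by
  obtain ⟨m, c, hm, hmc⟩ := z2PlaquettePairCov_le_exp_neg_of_lt_critical hDCGR hβ h
  exact z2PlaquettePairCov_le_exp_neg_of_prefactor hβ hm fun x N => (hmc x N).2

/-- **What remains of Duncan–Schweinhart's Thm 8 (`q = 2`, `d = 3`): the lower bounds, and
[DCGR20].** Granting Duminil-Copin–Goswami–Raoufi 2020 Thm 1.1 for `d = 3` (hypothesis `hDCGR`, the
shape of `DuminilCopinGoswamiRaoufi2020_truncatedTwoPointPlus_expDecay 3`) and the LOWER bounds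
`e^{-c₁N} ≤ Cov_β(W_{σ_0}, W_{σ_N})` for every `β > 0`, `β ≠ β_c` (finite energy of the plaquette
random-cluster representation — not in the tree), the named fact
`DuncanSchweinhart2026_z2GaugeThree_plaquetteCovDecay` holds: its upper bounds are theorems of the tree
on the deconfined side (`IsingGaugePlaquetteCovarianceDuality.lean`) and theorems modulo [DCGR20]
on the confined side (this file). [cite: DuncanSchweinhart2026, Thm 8 (p. 4) and Prop. 24 (pp. 19–20); DuminilCopinGoswamiRaoufi2020 Thm 1.1] -/
theorem DuncanSchweinhart2026_z2GaugeThree_plaquetteCovDecay_of_DCGR_of_lower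
    (hDCGR : ∀ β : ℝ, criticalBeta 3 < β → ∃ c : ℝ, 0 < c ∧ ∀ a b : Probability.LatticeModels.Site 3,
      plusCorr 3 β 0 (({a} : Finset (Probability.LatticeModels.Site 3)) ∆ {b}) -
        plusCorr 3 β 0 {a} * plusCorr 3 β 0 {b} ≤ Real.exp (-(c * ‖a - b‖)))
    (hlower : ∀ β : ℝ, 0 < β → β ≠ z2GaugeCriticalBetaThree →
      ∃ c₁ : ℝ, 0 < c₁ ∧ ∀ N : ℕ, 1 ≤ N → Real.exp (-(c₁ * N)) ≤ z2PlaquettePairCov β 0 N) :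
    DuncanSchweinhart2026_z2GaugeThree_plaquetteCovDecay :=
  DuncanSchweinhart2026_z2GaugeThree_plaquetteCovDecay_of_lower_of_confinedUpper hlower
    fun β hβ hlt => by
      obtain ⟨c₀, hc₀, hN⟩ := z2PlaquettePairCov_le_exp_neg_of_lt_critical' hDCGR hβ hlt
      exact ⟨c₀, hc₀, fun N hN1 => hN 0 N hN1⟩

/-- **The upper bound of Duncan–Schweinhart's Thm 8 (`q = 2`, `d = 3`) at EVERY `β ≠ β_c`, modulo
[DCGR20]** — the «`ξ_β < ∞`» (mass-gap) direction: for `β > 0`, `β ≠ β_c`, granting DCGR20 Thm 1.1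
at `d = 3`, there is `c₀ > 0` with `Cov_β(W_{σ(x)}, W_{σ(x)+Ne₃}) ≤ e^{-c₀N}` for all `x`, `N ≥ 1`.
[cite: DuncanSchweinhart2026, Thm 8 (p. 4); DuminilCopinGoswamiRaoufi2020 Thm 1.1] -/
theorem z2PlaquettePairCov_le_exp_neg_of_ne_critical
    (hDCGR : ∀ β : ℝ, criticalBeta 3 < β → ∃ c : ℝ, 0 < c ∧ ∀ a b : Probability.LatticeModels.Site 3,
      plusCorr 3 β 0 (({a} : Finset (Probability.LatticeModels.Site 3)) ∆ {b}) -
        plusCorr 3 β 0 {a} * plusCorr 3 β 0 {b} ≤ Real.exp (-(c * ‖a - b‖)))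
    {β : ℝ} (hβ : 0 < β) (hne : β ≠ z2GaugeCriticalBetaThree) :
    ∃ c₀ : ℝ, 0 < c₀ ∧ ∀ (x : Probability.LatticeModels.Site 3) (N : ℕ), 1 ≤ N →
      z2PlaquettePairCov β x N ≤ Real.exp (-(c₀ * N)) := by
  rcases lt_or_gt_of_ne hne with hlt | hgt
  · exact z2PlaquettePairCov_le_exp_neg_of_lt_critical' hDCGR hβ hlt
  · exact z2PlaquettePairCov_le_exp_neg_of_gt_critical' hgt

/-! ### §5 The same, from the tree's named fact `DuminilCopinGoswamiRaoufi2020_truncatedTwoPointPlus_expDecay` -/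

/-- The `d = 3` upper-bound content of the named fact DCGR20 Thm 1.1, in the hypothesis shape used
above. [cite: DuminilCopinGoswamiRaoufi2020, Thm 1.1] -/
theorem dcgr2020_three_upper (h : DuminilCopinGoswamiRaoufi2020_truncatedTwoPointPlus_expDecay 3) :
    ∀ β : ℝ, criticalBeta 3 < β → ∃ c : ℝ, 0 < c ∧ ∀ a b : Probability.LatticeModels.Site 3,
      plusCorr 3 β 0 (({a} : Finset (Probability.LatticeModels.Site 3)) ∆ {b}) -
        plusCorr 3 β 0 {a} * plusCorr 3 β 0 {b} ≤ Real.exp (-(c * ‖a - b‖)) := by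
  intro β hβ
  obtain ⟨c, hc, hab⟩ := h (by norm_num) β hβ
  exact ⟨c, hc, fun a b => (hab a b).2⟩

/-- **Confined-phase plaquette–plaquette mass gap of `ℤ₂` LGT₃ from the named fact DCGR20 Thm 1.1**:
`0 < β < β_c ⟹ ∃ m > 0, c, ∀ x N, 0 ≤ Cov_β(W_{σ(x)}, W_{σ(x)+Ne₃}) ≤ c e^{-mN}`.
[cite: DuncanSchweinhart2026, Thm 8 (p. 4) and proof of Prop. 24 (p. 20); DuminilCopinGoswamiRaoufi2020 Thm 1.1] -/
theorem z2PlaquettePairCov_le_exp_neg_of_lt_critical_of_DCGR2020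
    (h : DuminilCopinGoswamiRaoufi2020_truncatedTwoPointPlus_expDecay 3) {β : ℝ} (hβ : 0 < β)
    (hlt : β < z2GaugeCriticalBetaThree) :
    ∃ m c : ℝ, 0 < m ∧ ∀ (x : Probability.LatticeModels.Site 3) (N : ℕ),
      0 ≤ z2PlaquettePairCov β x N ∧ z2PlaquettePairCov β x N ≤ c * Real.exp (-(m * N)) :=
  z2PlaquettePairCov_le_exp_neg_of_lt_critical (dcgr2020_three_upper h) hβ hlt

/-- **The mass-gap direction of Duncan–Schweinhart's Thm 8 at every `β ≠ β_c`, from the named fact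
DCGR20 Thm 1.1** (`β > 0`): `∃ c₀ > 0, ∀ x, ∀ N ≥ 1, Cov_β(W_{σ(x)}, W_{σ(x)+Ne₃}) ≤ e^{-c₀N}` — the
confined side modulo the fact, the deconfined side unconditionally.
[cite: DuncanSchweinhart2026, Thm 8 (p. 4); DuminilCopinGoswamiRaoufi2020 Thm 1.1] -/
theorem z2PlaquettePairCov_le_exp_neg_of_ne_critical_of_DCGR2020
    (h : DuminilCopinGoswamiRaoufi2020_truncatedTwoPointPlus_expDecay 3) {β : ℝ} (hβ : 0 < β)
    (hne : β ≠ z2GaugeCriticalBetaThree) :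
    ∃ c₀ : ℝ, 0 < c₀ ∧ ∀ (x : Probability.LatticeModels.Site 3) (N : ℕ), 1 ≤ N →
      z2PlaquettePairCov β x N ≤ Real.exp (-(c₀ * N)) :=
  z2PlaquettePairCov_le_exp_neg_of_ne_critical (dcgr2020_three_upper h) hβ hne

/-- **Duncan–Schweinhart 2026 Thm 8 (`q = 2`, `d = 3`) follows from the named fact DCGR20 Thm 1.1 and
the lower bounds alone.** What the tree still lacks of the fact
`DuncanSchweinhart2026_z2GaugeThree_plaquetteCovDecay` is therefore exactly: (i) the discharge of
`DuminilCopinGoswamiRaoufi2020_truncatedTwoPointPlus_expDecay 3`, (ii) the lower bounds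
`e^{-c₁N} ≤ Cov_β` (finite energy). [cite: DuncanSchweinhart2026, Thm 8 (p. 4) and Prop. 24 (pp. 19–20); DuminilCopinGoswamiRaoufi2020 Thm 1.1] -/
theorem DuncanSchweinhart2026_z2GaugeThree_plaquetteCovDecay_of_DCGR2020_of_lower
    (h : DuminilCopinGoswamiRaoufi2020_truncatedTwoPointPlus_expDecay 3)
    (hlower : ∀ β : ℝ, 0 < β → β ≠ z2GaugeCriticalBetaThree →
      ∃ c₁ : ℝ, 0 < c₁ ∧ ∀ N : ℕ, 1 ≤ N → Real.exp (-(c₁ * N)) ≤ z2PlaquettePairCov β 0 N) :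
    DuncanSchweinhart2026_z2GaugeThree_plaquetteCovDecay :=
  DuncanSchweinhart2026_z2GaugeThree_plaquetteCovDecay_of_DCGR_of_lower (dcgr2020_three_upper h) hlower

end FactShape

end Literature.MathematicalPhysics.QuantumFieldTheory
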